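import Mathlib
import Summits.ResolutionOfSingularities.ResolutionOfSingularities.Theorems.RadicialJungCleanModelsCleanProp44LeafOrderDivision
import Literature.AlgebraicGeometry.Resolution.RegularLocalRingsQuotient
import HarnessLib

/-!
# Route `RadicialJung`, crux `CleanModels` (stmt-ResolutionOfSingularities-15917), line `Sketch` rev 35, stub 6 `stub_cleanProp44` (X44c):
# THE WEIGHTED LEAF ORDER IS A WELL-DEFINED NATURAL NUMBER — first brick of the measure (census (M)), def-free

Seat decomp-res-hand-2 g21 (structural hand).  The birth-chain descent (✓ `birth_descent_of_face`, ✓ `birth_descent_intrinsic`: every child's surrogate order satisfies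
`d′ ≤ δ − 1`) terminates chains once the tracked quantity `w(c) := max {d : J_c ⊆ Σ_{e≤μ} (t^e)·𝔪_c^{(μ−e)d}}` (the def-free surrogate of Hironaka's `δ(c, L)`,
✓ `…LeafOrderDivision`) is a WELL-DEFINED natural number at every birth.  Memo 4e §2.5: «`δ*(c) := max` over the representatives … (finite: bounded by Hironaka's `δ`,
which is finite since `dim Σ_μ ≤ 1`)».  THIS FILE proves, for a Noetherian local ring `R` (the stalk at `c`), `w ∈ 𝔪` (the leaf), `μ ≥ 1`:

* `leafSum_anti` — the surrogate is monotone: «`δ ≥ d`» ⟹ «`δ ≥ d′`» for `d′ ≤ d`.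
* `pow_le_leafSum_one` — `𝔪^μ ⊆ Σ_e (w^e)·𝔪^{(μ−e)}`: a NEAR point (`J ⊆ 𝔪^μ`) has «`δ ≥ 1`» for every leaf (hypothesis `1 ≤ d′_i` of ✓ `descent_le_sub_two` is free).
* `leafSum_le_span_sup_pow` — `Σ_e (w^e)·𝔪^{(μ−e)d} ⊆ (w) + 𝔪^{μd}`.
* `le_span_singleton_of_forall_leafSum` — **Krull**: «`δ ≥ d`» for EVERY `d` forces `J ⊆ (w)` (the leaf hypersurface would contain `V(J)`); so
* `exists_greatest_leafOrder` — **THE MEASURE EXISTS**: if `V(J) ⊄ V(w)` (`J ⊄ (w)`: `V(J)` has codimension `≥ 2`, the standing hypothesis of [CoP1] Prop. 4.2/4.4) and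
  `c` is near, there is a GREATEST `d ≥ 1` with «`δ ≥ d`», and every `d` with the surrogate is below it.

Honest framing: OURS, elementary; the lexicographic assembly with the printed `Λ` and the vertex count (census (M)) and the scheme side are NOT addressed; nothing here proves
X44c, any case of `CleanModels`, or resolution of singularities in characteristic `p`. [cite: CossartJannsenSaito2020, Def. 7.1, Lemma 7.5] [cite: Matsumura1987, Thm. 8.10 (Krull)]
[cite: CossartPiltant2008, Prop. 4.2, Prop. 4.4]
-/

noncomputable section

set_option linter.dupNamespace false -- mandated namespace of this single-conjunct summit

open IsLocalRing Literature.AlgebraicGeometry.Resolution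

namespace Summit.ResolutionOfSingularities.ResolutionOfSingularities.Theorems.RadicialJung.CleanModels

section Measure

variable {R : Type*} [CommRing R] (𝔪 : Ideal R) (w : R) (μ : ℕ)

/-- **Monotonicity of the surrogate**: `d′ ≤ d` ⟹ `Σ_e (w^e)·𝔪^{(μ−e)d} ⊆ Σ_e (w^e)·𝔪^{(μ−e)d′}`. [folklore] -/
theorem leafSum_anti {d d' : ℕ} (h : d' ≤ d) :
    (∑ e ∈ Finset.range (μ + 1), Ideal.span {w ^ e} * 𝔪 ^ ((μ - e) * d)) ≤
      ∑ e ∈ Finset.range (μ + 1), Ideal.span {w ^ e} * 𝔪 ^ ((μ - e) * d') :=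
  Finset.sum_le_sum fun _ _ => Ideal.mul_mono_right (Ideal.pow_le_pow_right (Nat.mul_le_mul_left _ h))

/-- **A near point has «`δ ≥ 1`» for every leaf**: `𝔪^μ ⊆ Σ_e (w^e)·𝔪^{(μ−e)·1}` (the `e = 0` summand). [folklore] -/
theorem pow_le_leafSum_one : 𝔪 ^ μ ≤ ∑ e ∈ Finset.range (μ + 1), Ideal.span {w ^ e} * 𝔪 ^ ((μ - e) * 1) := by
  have h : Ideal.span {w ^ 0} * 𝔪 ^ ((μ - 0) * 1) ≤ ∑ e ∈ Finset.range (μ + 1), Ideal.span {w ^ e} * 𝔪 ^ ((μ - e) * 1) :=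
    Finset.single_le_sum (f := fun e => Ideal.span {w ^ e} * 𝔪 ^ ((μ - e) * 1)) (fun _ _ => bot_le)
      (Finset.mem_range.mpr (Nat.zero_lt_succ μ))
  refine le_trans ?_ h
  rw [pow_zero, Ideal.span_singleton_one, Ideal.top_mul, Nat.sub_zero, mul_one]

/-- `Σ_e (w^e)·𝔪^{(μ−e)d} ⊆ (w) + 𝔪^{μd}`. [folklore] -/
theorem leafSum_le_span_sup_pow (d : ℕ) :
    (∑ e ∈ Finset.range (μ + 1), Ideal.span {w ^ e} * 𝔪 ^ ((μ - e) * d)) ≤ Ideal.span {w} ⊔ 𝔪 ^ (μ * d) := by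
  refine Finset.sum_induction _ (fun K : Ideal R => K ≤ Ideal.span {w} ⊔ 𝔪 ^ (μ * d)) (fun a b ha hb => ?_) (by simp) fun e _ => ?_
  · rw [Ideal.add_eq_sup]; exact sup_le ha hb
  · rcases Nat.eq_zero_or_pos e with rfl | he
    · rw [pow_zero, Ideal.span_singleton_one, Ideal.top_mul, Nat.sub_zero]; exact le_sup_right
    · refine Ideal.mul_le_right.trans (le_sup_left.trans' ?_)
      rw [Ideal.span_singleton_le_iff_mem]
      exact Ideal.pow_mem_of_mem _ (Ideal.mem_span_singleton_self w) e he

universe u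

variable {A : Type u} [CommRing A] [IsNoetherianRing A] [IsLocalRing A]

/-- **Krull: «`δ ≥ d`» for every `d` forces `J ⊆ (w)`** (`w ∈ 𝔪`, `μ ≥ 1`; Krull's intersection theorem in the local ring `A/(w)`).
[cite: Matsumura1987, Thm. 8.10] -/
theorem le_span_singleton_of_forall_leafSum {w : A} (hw : w ∈ maximalIdeal A) {μ : ℕ} (hμ : 0 < μ) {J : Ideal A}
    (h : ∀ d : ℕ, J ≤ ∑ e ∈ Finset.range (μ + 1), Ideal.span {w ^ e} * maximalIdeal A ^ ((μ - e) * d)) :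
    J ≤ Ideal.span {w} := by
  have hne : Ideal.span {w} ≠ ⊤ := Ideal.span_singleton_ne_top (fun hu => (IsLocalRing.mem_maximalIdeal _).mp hw hu)
  haveI : Nontrivial (A ⧸ Ideal.span {w}) := Ideal.Quotient.nontrivial_iff.mpr hne
  haveI := isLocalRing_quotient hne
  have hK := Ideal.iInf_pow_eq_bot_of_isLocalRing (I := maximalIdeal (A ⧸ Ideal.span {w}))
    (Ideal.IsPrime.ne_top inferInstance)
  intro x hx
  have hmem : Ideal.Quotient.mk (Ideal.span {w}) x ∈ ⨅ i : ℕ, maximalIdeal (A ⧸ Ideal.span {w}) ^ i := by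
    rw [Ideal.mem_iInf]
    intro i
    have h1 : x ∈ Ideal.span {w} ⊔ maximalIdeal A ^ i := by
      have h2 := leafSum_le_span_sup_pow (maximalIdeal A) w μ i (h i hx)
      have h3 : Ideal.span {w} ⊔ maximalIdeal A ^ (μ * i) ≤ Ideal.span {w} ⊔ maximalIdeal A ^ i :=
        sup_le_sup_left (Ideal.pow_le_pow_right (Nat.le_mul_of_pos_left i hμ)) _
      exact h3 h2
    rw [maximalIdeal_quotient_eq_map, ← Ideal.map_pow, Ideal.mem_quotient_iff_mem_sup, sup_comm]
    exact h1
  rw [hK] at hmem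
  exact Ideal.Quotient.eq_zero_iff_mem.mp hmem

/-- **THE WEIGHTED LEAF ORDER IS A WELL-DEFINED NATURAL NUMBER** (the measure of census (M) at a birth): if `J ⊄ (w)` (`V(J)` is not contained in the leaf
hypersurface — automatic when `V(J)` has codimension `≥ 2`) and «`δ ≥ 1`» holds (a near point, ✓ `pow_le_leafSum_one`), then there is a GREATEST `m ≥ 1` with
«`δ ≥ m`», and every `d` with «`δ ≥ d`» satisfies `d ≤ m`. [cite: CossartJannsenSaito2020, Def. 7.1] [cite: CossartPiltant2008, Prop. 4.4 (proof, p. 11)] -/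
theorem exists_greatest_leafOrder {w : A} (hw : w ∈ maximalIdeal A) {μ : ℕ} (hμ : 0 < μ) {J : Ideal A} (hJ : ¬ J ≤ Ideal.span {w})
    (h1 : J ≤ ∑ e ∈ Finset.range (μ + 1), Ideal.span {w ^ e} * maximalIdeal A ^ ((μ - e) * 1)) :
    ∃ m : ℕ, 1 ≤ m ∧ (J ≤ ∑ e ∈ Finset.range (μ + 1), Ideal.span {w ^ e} * maximalIdeal A ^ ((μ - e) * m)) ∧
      ∀ d : ℕ, (J ≤ ∑ e ∈ Finset.range (μ + 1), Ideal.span {w ^ e} * maximalIdeal A ^ ((μ - e) * d)) → d ≤ m := by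
  classical
  set S : Set ℕ := {d | J ≤ ∑ e ∈ Finset.range (μ + 1), Ideal.span {w ^ e} * maximalIdeal A ^ ((μ - e) * d)} with hS
  have hS1 : (1 : ℕ) ∈ S := h1
  -- `S` is bounded: otherwise (monotonicity) every `d` lies in `S`, and Krull gives `J ⊆ (w)`
  have hbdd : BddAbove S := by
    by_contra hnb
    apply hJ
    refine le_span_singleton_of_forall_leafSum hw hμ fun d => ?_
    obtain ⟨d₁, hd₁S, hdd₁⟩ : ∃ d₁ ∈ S, d < d₁ := by
      by_contra hc
      push Not at hc
      exact hnb ⟨d, fun d₁ hd₁ => hc d₁ hd₁⟩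
    exact hd₁S.trans (leafSum_anti (maximalIdeal A) w μ hdd₁.le)
  refine ⟨sSup S, ?_, Nat.sSup_mem ⟨1, hS1⟩ hbdd, fun d hd => le_csSup hbdd hd⟩
  exact le_csSup hbdd hS1

/-- The near-point form: `J ⊆ 𝔪^μ` (the birth is a near point of `(J, μ)`) and `J ⊄ (w)` give the greatest leaf order directly.
[cite: CossartPiltant2008, Prop. 4.4 (proof, p. 11)] -/
theorem exists_greatest_leafOrder_of_near {w : A} (hw : w ∈ maximalIdeal A) {μ : ℕ} (hμ : 0 < μ) {J : Ideal A}
    (hJ : ¬ J ≤ Ideal.span {w}) (hnear : J ≤ maximalIdeal A ^ μ) :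
    ∃ m : ℕ, 1 ≤ m ∧ (J ≤ ∑ e ∈ Finset.range (μ + 1), Ideal.span {w ^ e} * maximalIdeal A ^ ((μ - e) * m)) ∧
      ∀ d : ℕ, (J ≤ ∑ e ∈ Finset.range (μ + 1), Ideal.span {w ^ e} * maximalIdeal A ^ ((μ - e) * d)) → d ≤ m :=
  exists_greatest_leafOrder hw hμ hJ (hnear.trans (pow_le_leafSum_one (maximalIdeal A) w μ))

end Measure

end Summit.ResolutionOfSingularities.ResolutionOfSingularities.Theorems.RadicialJung.CleanModels

end
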